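import Summits.HodgeConjecture.HodgeConjecture.Theorems.MarkmanPartnerTransportPicardThreeK3SquaresKugaSatakeSelfPresentation
import Summits.HodgeConjecture.HodgeConjecture.Theorems.Ring2AbelianAllAndreTransposedInverses
import Summits.HodgeConjecture.HodgeConjecture.Theorems.Ring2AbelianAllAndreCorrespondenceCategory
import Literature.AlgebraicGeometry.HodgeTheory.DominatedByPowersHodgeConjectureHolds
import Literature.AlgebraicGeometry.HodgeTheory.HodgeTypeVanishing
import Literature.AlgebraicGeometry.HodgeTheory.LefschetzOneOneHolds
import Literature.AlgebraicGeometry.HodgeTheory.SupportedClassesRationalProofs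
import Mathlib.LinearAlgebra.Dual.Lemmas

/-!
# Route MarkmanPartnerTransport · crux `PicardThreeK3Squares` (stmt-HodgeConjecture-19652) —
# rational descent for algebraic self-correspondences on `T(S)`, the subfield trick, and the sign of
# the multiplier of a self-similitude (programme «KS-SELF», step 4a)

Tools for the assembly file `…KugaSatakeSelfSimilitude` (a rational Hodge self-similitude of `T(S)` is
algebraic granted the Kuga–Satake statement for `S`, WITHOUT Varesco's theorem). In the tree, "induced
by an algebraic cycle" (`IsAlgebraicCorrespondence`) means induced by a class of the `ℂ`-SPAN
`algebraicClasses` of the cycle classes, so an algebraic correspondence need not preserve rational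
classes; the descent to the RATIONAL endomorphism field `End_Hdg(T(S)_ℚ)` (where Zarhin's theorem
lives) is therefore done generator-by-generator and through `ℚ`-linear retractions `ℂ → ℚ`:

* §1 `exists_baseChange_eq_of_transc` — `{y | y ⊥ N¹(S)} = Θ(ℂ ⊗ T(S)_ℚ)`; `transc_of_twoZero`.
* §2 `transc_of_isAlgebraicCorrespondence` — **algebraic self-correspondences of `S` preserve `T(S)_ℂ`**
  (adjunction with the algebraic transpose, which maps `N¹(S)` into `N¹(S)`: on the complexified Hodge
  classes by Lefschetz `(1,1)` for the RATIONAL algebraic generators, `corrAction_ofRatClass_mem_algebraicClasses`);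
  `exists_endAlg_of_isRationalClass` — **`[γ]_*` for a RATIONAL algebraic `γ` descends to
  `End_Hdg(T(S)_ℚ)`**.
* §2b `exists_rat_retraction_ne_zero` — for `0 ≠ ξ ∈ ℂ ⊗_ℚ V` some `ℚ`-linear `r : ℂ → ℚ` has
  `(r ⊗ 1) ξ ≠ 0`.
* §3 `mem_of_mul_eq_of_isField` — **THE SUBFIELD TRICK**: in a field `E ⊆ End(V)`, a product-closed
  finite-dimensional subspace `R` with `a₂ g = a₁ ≠ 0`, `a₁, a₂ ∈ R`, `g ∈ E`, contains `g`.
* §4 `multiplier_pos` — the multiplier `d` of a cup-self-adjoint rational Hodge self-similitude is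
  positive (`ψσ = λσ`, `λ` real, `d = λ²`).

THEOREMS ONLY; no definition, no named fact, no sorry; credits nothing to the Hodge conjecture.
Prover seat hodge-nonav-19652-p1 (gen 14), `--supports stmt-HodgeConjecture-19652`.

References: M. Varesco, Math. Z. 305 (2023), §0.3 and Thm. 4.5; D. Huybrechts, Comment. Math. Helv.
94 (2019), Rem. 3.3; C. Voisin, *Hodge Theory I*, §7.1.1, Thm. 11.30, Lemma 11.41; Yu. G. Zarhin,
J. reine angew. Math. 341 (1983), Thm. 1.5.1.
-/

set_option linter.dupNamespace false

noncomputable section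

namespace Summit.HodgeConjecture.HodgeConjecture.Theorems.MarkmanPartnerTransport.KugaSatakeSelf

open scoped TensorProduct
open CategoryTheory MonoidalCategory Literature.AlgebraicGeometry Literature.AlgebraicGeometry.Motives
open Literature.AlgebraicGeometry.HodgeTheory Literature.AlgebraicTopology.SingularHomology
open Literature.AlgebraicGeometry.Motives.HodgeStructure
open Literature.AlgebraicGeometry.Surfaces
open Summit.HodgeConjecture.HodgeConjecture.Theorems.OddPrimeSquares
open Summit.HodgeConjecture.HodgeConjecture.Theorems.MarkmanPartnerTransport.TranscendentalPresentation
open Summit.HodgeConjecture.HodgeConjecture.Ring2.AbelianAll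

variable {S : SchemeOver ℂ}

/-- `H²_B(S)`: the weight-two `ℚ`-Hodge structure on `H²(S(ℂ); ℚ)` of the real Hodge model of `S`. -/
local notation3 "H²[" hS "]" =>
  bettiTwoHodgeStructure hS (BettiUniverse.realHodgeModel exists_isReal_hodgeModel_holds hS)
    (BettiUniverse.realHodgeModel_isHodgeSymmetric exists_isReal_hodgeModel_holds hS)

/-- `T(S)_ℚ = Hdg¹^⊥ ⊆ H²(S(ℂ); ℚ)`. -/
local notation3 "T[" hS "]" =>
  transcendentalLatticeBetti hS (BettiUniverse.realHodgeModel exists_isReal_hodgeModel_holds hS)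
    (BettiUniverse.realHodgeModel_isHodgeSymmetric exists_isReal_hodgeModel_holds hS)

/-- `Θ : ℂ ⊗_ℚ H²(S(ℂ); ℚ) → H²(S(ℂ); ℂ)`. -/
local notation3 "Θ[" S "]" => ofRatClassBaseChange (Motives.ComplexPoints S) (2 * 1)

/-- `ι : H²(S(ℂ); ℚ) → H²(S(ℂ); ℂ)`, the rational lattice. -/
local notation3 "ι[" S "]" => ofRatClass (Motives.ComplexPoints S) (2 * 1)

/-- `Transc[S, y]`: `y` is cup-orthogonal to `N¹(S) = algebraicClasses S 1`. Local notation only. -/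
local notation3 (prettyPrint := false) "Transc[" S ", " y "]" =>
  (∀ d ∈ algebraicClasses S 1, cupProduct (rfl : 2 * 1 + 2 * 1 = 2 * 2) y d = 0)

/-! ### §1 `T(S)_ℂ` is the complexified transcendental lattice -/

/-- `Θ (x ⊗ sub) ⊥ N¹(S)` for `x ∈ ℂ ⊗ T(S)_ℚ`. [cite: Huybrechts2016K3, Ch. 3 Lemma 3.1] -/
theorem transc_of_baseChange (hS : IsSmoothProjective 2 S) (T : SubHodgeStructure (H²[hS]))
    (hT : T.toSubmodule = T[hS]) (x : ℂ ⊗[ℚ] T.toSubmodule) :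
    Transc[S, Θ[S] (T.toSubmodule.subtype.baseChange ℂ x)] := by
  intro c hc
  induction x using TensorProduct.induction_on with
  | zero => rw [map_zero, map_zero, LinearMap.map_zero₂]
  | tmul a t =>
    rw [LinearMap.baseChange_tmul, Submodule.subtype_apply, ofRatClassBaseChange_tmul, LinearMap.map_smul₂,
      (mem_transcendental_iff_transc hS _).1 ((le_of_eq hT : T.toSubmodule ≤ T[hS]) t.2) c hc, smul_zero]
  | add x y hx hy => rw [map_add, map_add, LinearMap.map_add₂, hx, hy, add_zero]

/-- **`{y | y ⊥ N¹(S)} = Θ(T(S)_ℚ ⊗ ℂ)`**: a class cup-orthogonal to the algebraic divisor classes is the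
complexification of a vector of `ℂ ⊗ T(S)_ℚ` (`(Hdg¹^⊥)_ℂ = (Hdg¹_ℂ)^⊥`, `baseChange_orthogonal_eq`, and
`Θ(Hdg¹_ℂ) = N¹(S)`). [cite: Huybrechts2016K3, Ch. 3 Lemma 3.1] -/
theorem exists_baseChange_eq_of_transc (hS : IsSmoothProjective 2 S) (T : SubHodgeStructure (H²[hS]))
    (hT : T.toSubmodule = T[hS]) {y : complexBetti S (2 * 1)} (hy : Transc[S, y]) :
    ∃ x : ℂ ⊗[ℚ] T.toSubmodule, Θ[S] (T.toSubmodule.subtype.baseChange ℂ x) = y := by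
  haveI : Module.Finite ℚ (bettiCohomology S (2 * 1)) := BettiUniverse.finite hS (2 * 1)
  obtain ⟨z, rfl⟩ := ofRatClassBaseChange_surjective hS (2 * 1) y
  have hz : z ∈ (T[hS]).baseChange ℂ := by
    rw [transcendentalLatticeBetti, baseChange_orthogonal_eq _ (cupPairingBetti_nondegenerate hS),
      LinearMap.BilinForm.mem_orthogonal_iff]
    intro w hw
    have hΘw : Θ[S] w ∈ algebraicClasses S 1 := by
      rw [← map_hodgeClasses_baseChange_eq_algebraicClasses hS]
      exact ⟨w, hw, rfl⟩
    change (cupPairingBetti hS).baseChange ℂ w z = 0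
    rw [cupPairingBetti_baseChange_eq_traceC,
      cupProduct_gradedComm_holds ℂ (Motives.ComplexPoints S) rfl rfl (Θ[S] w) (Θ[S] z), hy _ hΘw, smul_zero,
      map_zero]
  rw [← hT] at hz
  obtain ⟨x, hx⟩ := hz
  exact ⟨x, congrArg (Θ[S]) hx⟩

/-- A `(2,0)`-class is cup-orthogonal to `N¹(S)` (type `(2,0) ∪ (1,1) = (3,1)` vanishes on a surface).
[cite: VoisinHodgeI2002, §7.1.2 and Lemma 7.30] -/
theorem transc_of_twoZero (hS : IsSmoothProjective 2 S) {σ : complexBetti S (2 * 1)}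
    (hσ : IsOfHodgeType 2 S (2 * 1) 2 0 σ) : Transc[S, σ] := by
  intro c hc
  have hc11 := isOfHodgeType_of_mem_algebraicClasses_of_isSmoothProjective hS 1 hc
  have h := BettiUniverse.cupPreservesHodgeType exists_isReal_hodgeModel_holds
    hodgePQ_independent_of_hodgeModel_holds hS (rfl : 2 * 1 + 2 * 1 = 2 * 2) hσ hc11
  exact h.eq_zero_of_lt hS (Or.inl (by norm_num))

/-! ### §2 Algebraic self-correspondences preserve `T(S)_ℂ`; rational ones descend to `End_Hdg(T(S)_ℚ)` -/

/-- `Θ(conj x) = conjClass (Θ x)` (through the real Hodge model). [cite: VoisinHodgeI2002, Cor. 6.12] -/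
theorem ofRatClassBaseChange_conj_eq (hS : IsSmoothProjective 2 S) (x : ℂ ⊗[ℚ] bettiCohomology S (2 * 1)) :
    Θ[S] (HodgeStructure.conj x) = conjClass _ (2 * 1) (Θ[S] x) :=
  KaehlerRationalDatum.ofRatClassBaseChange_conj hS (BettiUniverse.realHodgeModel exists_isReal_hodgeModel_holds hS) x

/-- **`[γ]_* ` maps the complexified Hodge classes `ι n`, `n ∈ Hdg¹(S)`, into `N¹(S)`** for every
`γ ∈ A²(S × S) ⊗ ℂ` (`γ` is a `ℂ`-combination of RATIONAL algebraic classes,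
`supportedClasses_eq_span_isRationalClass`; for those, `[γₖ]_*(ι n)` is a rational `(1,1)`-class, algebraic
by Lefschetz `(1,1)`). [cite: VoisinHodgeI2002, Thm. 11.30 and Lemma 11.41] -/
theorem corrAction_ofRatClass_mem_algebraicClasses (hS : IsSmoothProjective 2 S) {e : ℕ}
    (hab : 2 * 1 + 2 * e = 2 * 1 + 2 * 2) {γ : complexBetti (S ⊗ S) (2 * e)} (hγ : γ ∈ algebraicClasses (S ⊗ S) e)
    {n : bettiCohomology S (2 * 1)} (hn : n ∈ (H²[hS]).hodgeClasses 1) :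
    corrAction complexOrientationFamily hS hS hab γ (ι[S] n) ∈ algebraicClasses S 1 := by
  have hnN := ofRatClass_mem_algebraicClasses_of_mem_hodgeClasses hS hn
  have hn11 := isOfHodgeType_of_mem_algebraicClasses_of_isSmoothProjective hS 1 hnN
  have hγ' := (le_of_eq (supportedClasses_eq_span_isRationalClass (hS.tensor_holds hS) (2 * e) e)) hγ
  clear hγ
  induction hγ' using Submodule.span_induction with
  | mem γ hγ =>
    have hγt : IsOfHodgeType (2 + 2) (S ⊗ S) (2 * e) e e γ :=
      isOfHodgeType_of_mem_algebraicClasses_of_isSmoothProjective (hS.tensor_holds hS) e hγ.2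
    have h1 : IsRationalClass (corrAction complexOrientationFamily hS hS hab γ (ι[S] n)) :=
      Arapura2006.isRationalClass_corrAction_complex hS hS hab hγ.1 (isRationalClass_ofRatClass _)
    have h2 : IsOfHodgeType 2 S (2 * 1) 1 1 (corrAction complexOrientationFamily hS hS hab γ (ι[S] n)) :=
      Arapura2006.isOfHodgeType_corrAction_complex hS hS hab hγt (by omega) (by omega) hn11
    exact lefschetzOneOne_rational_holds hS _ h1 h2
  | zero => rw [map_zero, LinearMap.zero_apply]; exact Submodule.zero_mem _
  | add γ γ' _ _ h h' => rw [map_add, LinearMap.add_apply]; exact Submodule.add_mem _ h h'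
  | smul c γ _ h => rw [map_smul, LinearMap.smul_apply]; exact Submodule.smul_mem _ c h

/-- **An algebraic self-correspondence of `S` maps `T(S)_ℂ` into itself**: for `f` induced by an
algebraic cycle and `y ⊥ N¹(S)`, `f y ⊥ N¹(S)` (adjunction with the algebraic transpose `ᵗf`, which
maps `N¹(S)` into `N¹(S)`). [cite: Fulton1998, §16.1] [cite: VoisinHodgeI2002, Thm. 11.30] -/
theorem transc_of_isAlgebraicCorrespondence (hS : IsSmoothProjective 2 S)
    {f : complexBetti S (2 * 1) →ₗ[ℂ] complexBetti S (2 * 1)} (hf : IsAlgebraicCorrespondence 2 2 S S f)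
    {y : complexBetti S (2 * 1)} (hy : Transc[S, y]) : Transc[S, f y] := by
  have ha : 2 * 1 + 2 * 1 = 2 * 2 := rfl
  obtain ⟨ft, hft, hadj⟩ := IsAlgebraicCorrespondence.exists_transpose hS hS ha ha hf
  obtain ⟨e, hab, γ, hγ, rfl⟩ := IsAlgebraicCorrespondence.exists_eq_corrAction hS hS hft
  -- on the complexified Hodge classes `ι n`, `n ∈ Hdg¹`
  have key : ∀ n : bettiCohomology S (2 * 1), n ∈ (H²[hS]).hodgeClasses 1 →
      cupProduct (rfl : 2 * 1 + 2 * 1 = 2 * 2) (f y) (ι[S] n) = 0 := by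
    intro n hn
    have hmem := corrAction_ofRatClass_mem_algebraicClasses hS hab hγ hn
    have h0 : cupPairing (complexOrientationFamily hS) ha
        (corrAction complexOrientationFamily hS hS hab γ (ι[S] n)) y = 0 := by
      rw [cupPairing_apply, cupProduct_gradedComm_holds ℂ (Motives.ComplexPoints S) ha rfl _ y, hy _ hmem,
        smul_zero, map_zero, LinearMap.zero_apply]
    have h3 := hadj y (ι[S] n)
    rw [h0, mul_zero, cupPairing_apply] at h3
    apply eq_zero_of_traceC_eq_zero hS
    rw [traceC_apply, h3, mul_zero]
  -- extend to `N¹(S) = Θ(Hdg¹_ℂ)` by linearity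
  intro c hc
  rw [← map_hodgeClasses_baseChange_eq_algebraicClasses hS] at hc
  obtain ⟨u, hu, rfl⟩ := hc
  obtain ⟨u', rfl⟩ := hu
  induction u' using TensorProduct.induction_on with
  | zero => rw [map_zero, map_zero, map_zero]
  | tmul a n =>
    rw [LinearMap.baseChange_tmul, Submodule.subtype_apply, ofRatClassBaseChange_tmul, map_smul, key _ n.2,
      smul_zero]
  | add x y hx hy => rw [map_add, map_add, map_add, hx, hy, add_zero]

/-- **A RATIONAL algebraic self-correspondence `[γ]_*` of `S` descends to a Hodge endomorphism of
`T(S)_ℚ`**: for a rational algebraic `γ ∈ A²(S × S)` there is `a ∈ End_Hdg(T(S)_ℚ)` with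
`[γ]_*(t ⊗ 1) = a(t) ⊗ 1` for `t ∈ T(S)_ℚ` (`[γ]_*` is rational and type-preserving,
`exists_hom_ofRatClass_eq`, and preserves `T(S)`, `transc_of_isAlgebraicCorrespondence`).
[cite: VoisinHodgeI2002, §7.3.1 and Lemma 11.41] -/
theorem exists_endAlg_of_isRationalClass (hS : IsSmoothProjective 2 S)
    (T : SubHodgeStructure (H²[hS])) (hT : T.toSubmodule = T[hS]) {e : ℕ} (hab : 2 * 1 + 2 * e = 2 * 1 + 2 * 2)
    {γ : complexBetti (S ⊗ S) (2 * e)} (hγ : γ ∈ algebraicClasses (S ⊗ S) e) (hγQ : IsRationalClass γ) :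
    ∃ a : Module.End ℚ T.toSubmodule, a ∈ T.toHodgeStructure.endAlg ∧
      ∀ t : T.toSubmodule, corrAction complexOrientationFamily hS hS hab γ (ι[S] (t : bettiCohomology S (2 * 1))) =
        ι[S] ((a t : T.toSubmodule) : bettiCohomology S (2 * 1)) := by
  set f := corrAction complexOrientationFamily hS hS hab γ with hf
  have hfalg : IsAlgebraicCorrespondence 2 2 S S f :=
    isAlgebraicCorrespondence_corrAction_complex hS hS hab (by norm_num) hγ
  have hγt : IsOfHodgeType (2 + 2) (S ⊗ S) (2 * e) e e γ :=
    isOfHodgeType_of_mem_algebraicClasses_of_isSmoothProjective (hS.tensor_holds hS) e hγ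
  have h1 : ∀ y, IsRationalClass y → IsRationalClass (f y) :=
    fun y hy => Arapura2006.isRationalClass_corrAction_complex hS hS hab hγQ hy
  have h2 : ∀ (i j : ℕ) y, IsOfHodgeType 2 S (2 * 1) i j y → IsOfHodgeType 2 S (2 * 1) i j (f y) :=
    fun i j y hy => Arapura2006.isOfHodgeType_corrAction_complex hS hS hab hγt (by omega) (by omega) hy
  obtain ⟨Ψ, hΨ⟩ := exists_hom_ofRatClass_eq hS f h1 h2
  have hmem : ∀ t : T.toSubmodule, (Ψ.comp T.subtypeHom).toLinearMap t ∈ T.toSubmodule := by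
    intro t
    have ht : Transc[S, ι[S] (t : bettiCohomology S (2 * 1))] :=
      (mem_transcendental_iff_transc hS _).1 ((le_of_eq hT : T.toSubmodule ≤ T[hS]) t.2)
    have h : Ψ.toLinearMap (t : bettiCohomology S (2 * 1)) ∈ T[hS] := by
      rw [mem_transcendental_iff_transc hS, hΨ]
      exact transc_of_isAlgebraicCorrespondence hS hfalg ht
    exact (le_of_eq hT.symm : T[hS] ≤ T.toSubmodule) h
  refine ⟨((Ψ.comp T.subtypeHom).codRestrict T hmem).toLinearMap,
    ((Ψ.comp T.subtypeHom).codRestrict T hmem).map_F_le, fun t => (hΨ _).symm⟩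

/-! ### §2b Rational retractions `ℂ → ℚ` read off coordinates -/

/-- **Coordinates along a rational basis detect non-vanishing through a `ℚ`-linear functional on `ℂ`.**
For a finite-dimensional `ℚ`-space `V` and `0 ≠ ξ ∈ ℂ ⊗_ℚ V` there is a `ℚ`-linear `r : ℂ → ℚ` with
`(r ⊗ 1) ξ ≠ 0` in `V` (write `ξ = Σⱼ zⱼ ⊗ bⱼ` in a basis; some `zⱼ ≠ 0`; take `r(zⱼ) ≠ 0`). [folklore] -/
theorem exists_rat_retraction_ne_zero {V : Type*} [AddCommGroup V] [Module ℚ V] [Module.Finite ℚ V]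
    {ξ : ℂ ⊗[ℚ] V} (hξ : ξ ≠ 0) :
    ∃ r : ℂ →ₗ[ℚ] ℚ, TensorProduct.lid ℚ V (r.rTensor V ξ) ≠ 0 := by
  classical
  let b := Module.finBasis ℚ V
  -- coordinates `coordⱼ : ℂ ⊗ V → ℂ`, `c ⊗ v ↦ (b.coord j v) • c`
  let coord : Fin (Module.finrank ℚ V) → (ℂ ⊗[ℚ] V →ₗ[ℚ] ℂ) := fun j =>
    (TensorProduct.rid ℚ ℂ).toLinearMap ∘ₗ (b.coord j).lTensor ℂ
  have hcoord : ∀ j (c : ℂ) (v : V), coord j (c ⊗ₜ v) = (b.coord j v) • c := by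
    intro j c v
    simp [coord, LinearMap.lTensor_tmul, TensorProduct.rid_tmul]
  -- `ξ = Σⱼ coordⱼ ξ ⊗ bⱼ`
  have hsum : ∀ x : ℂ ⊗[ℚ] V, ∑ j, coord j x ⊗ₜ[ℚ] b j = x := by
    intro x
    induction x using TensorProduct.induction_on with
    | zero => simp
    | tmul c v =>
      conv_rhs => rw [← b.sum_repr v, TensorProduct.tmul_sum]
      refine Finset.sum_congr rfl fun j _ => ?_
      rw [hcoord, Module.Basis.coord_apply, TensorProduct.tmul_smul, TensorProduct.smul_tmul']
    | add x y hx hy => simp only [map_add, TensorProduct.add_tmul, Finset.sum_add_distrib, hx, hy]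
  -- some coordinate is non-zero
  obtain ⟨j₀, hj₀⟩ : ∃ j, coord j ξ ≠ 0 := by
    by_contra hall
    push Not at hall
    apply hξ
    rw [← hsum ξ]
    simp [hall]
  obtain ⟨r, hr⟩ : ∃ r : Module.Dual ℚ ℂ, r (coord j₀ ξ) ≠ 0 := by
    by_contra hall
    push Not at hall
    exact hj₀ ((Module.forall_dual_apply_eq_zero_iff ℚ (coord j₀ ξ)).1 hall)
  refine ⟨r, fun h0 => hr ?_⟩
  -- `b.coord j₀ ((r ⊗ 1) ξ) = r (coord j₀ ξ)`
  have hkey : ∀ x : ℂ ⊗[ℚ] V, b.coord j₀ (TensorProduct.lid ℚ V (r.rTensor V x)) = r (coord j₀ x) := by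
    intro x
    induction x using TensorProduct.induction_on with
    | zero => simp
    | tmul c v => rw [LinearMap.rTensor_tmul, TensorProduct.lid_tmul, map_smul, hcoord, map_smul,
        smul_eq_mul, smul_eq_mul, mul_comm]
    | add x y hx hy => simp only [map_add, hx, hy]
  rw [← hkey ξ, h0, map_zero]

/-- The retraction `ρ_r = (r ⊗ 1) : ℂ ⊗_ℚ V → V` on pure tensors: `ρ_r(c ⊗ v) = r(c) v`. [folklore] -/
theorem lid_rTensor_tmul {V : Type*} [AddCommGroup V] [Module ℚ V] (r : ℂ →ₗ[ℚ] ℚ) (c : ℂ) (v : V) :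
    TensorProduct.lid ℚ V (r.rTensor V (c ⊗ₜ[ℚ] v)) = r c • v := by
  rw [LinearMap.rTensor_tmul, TensorProduct.lid_tmul]

/-! ### §3 The subfield trick -/

/-- **THE SUBFIELD TRICK** (Huybrechts CMH 2019 Rem. 3.3 / Varesco §0.3: "the endomorphism field is
generated by the algebraic ones"). Let `E` be a subalgebra of `End(V)` which is a FIELD (`V`
finite-dimensional over `ℚ`), `R ⊆ E` a `ℚ`-subspace closed under products, `a₁, a₂ ∈ R`, `g ∈ E` with
`a₂ g = a₁ ≠ 0`. Then `g ∈ R`: right multiplication by `a₂ ≠ 0` is an injective, hence surjective,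
linear endomorphism of the finite-dimensional `R`, so `r a₂ = a₁ = g a₂` for some `r ∈ R`, and `r = g`
(no zero divisors in `E`). [cite: Varesco2023, §0.3 (p. 4)] -/
theorem mem_of_mul_eq_of_isField {V : Type*} [AddCommGroup V] [Module ℚ V] [Module.Finite ℚ V]
    {E : Subalgebra ℚ (Module.End ℚ V)} (hE : IsField E) (R : Submodule ℚ (Module.End ℚ V))
    (hRE : ∀ a ∈ R, a ∈ E) (hmul : ∀ a ∈ R, ∀ b ∈ R, a * b ∈ R)
    {a₁ a₂ g : Module.End ℚ V} (ha₁ : a₁ ∈ R) (ha₂ : a₂ ∈ R) (hg : g ∈ E) (ha₁0 : a₁ ≠ 0)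
    (h : a₂ * g = a₁) : g ∈ R := by
  -- no zero divisors in `E`
  have hnzd : ∀ a b : Module.End ℚ V, a ∈ E → b ∈ E → a * b = 0 → a = 0 ∨ b = 0 := by
    intro a b ha hb hab
    by_cases ha0 : a = 0
    · exact Or.inl ha0
    · have ha0' : (⟨a, ha⟩ : E) ≠ 0 := fun h0 => ha0 (congrArg Subtype.val h0)
      obtain ⟨c, hc⟩ := hE.mul_inv_cancel ha0'
      refine Or.inr ?_
      have hcomm := hE.mul_comm ⟨a, ha⟩ c
      have h1 : ((c : E) : Module.End ℚ V) * a = 1 := by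
        rw [hcomm] at hc
        exact congrArg Subtype.val hc
      calc b = ((c : Module.End ℚ V) * a) * b := by rw [h1, one_mul]
        _ = (c : Module.End ℚ V) * (a * b) := by rw [mul_assoc]
        _ = 0 := by rw [hab, mul_zero]
  have ha₂0 : a₂ ≠ 0 := by rintro rfl; exact ha₁0 (by rw [← h, zero_mul])
  -- right multiplication by `a₂` on `R`
  let L : R →ₗ[ℚ] R :=
    { toFun := fun r => ⟨(r : Module.End ℚ V) * a₂, hmul _ r.2 _ ha₂⟩
      map_add' := fun r r' => Subtype.ext (add_mul _ _ _)
      map_smul' := fun c r => Subtype.ext (smul_mul_assoc _ _ _) }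
  have hLinj : Function.Injective L := by
    intro r r' hrr'
    have h0 : ((r : Module.End ℚ V) - r') * a₂ = 0 := by
      rw [sub_mul, sub_eq_zero]
      exact congrArg Subtype.val hrr'
    rcases hnzd _ _ (E.sub_mem (hRE _ r.2) (hRE _ r'.2)) (hRE _ ha₂) h0 with h0 | h0
    · exact Subtype.ext (sub_eq_zero.1 h0)
    · exact absurd h0 ha₂0
  have hLsurj : Function.Surjective L := LinearMap.surjective_of_injective hLinj
  obtain ⟨r, hr⟩ := hLsurj ⟨a₁, ha₁⟩
  have hr' : (r : Module.End ℚ V) * a₂ = a₁ := congrArg Subtype.val hr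
  -- `g a₂ = a₂ g = a₁` (commutativity in the field `E`)
  have hga : g * a₂ = a₁ := by
    have hc := hE.mul_comm ⟨a₂, hRE _ ha₂⟩ ⟨g, hg⟩
    have hc' : a₂ * g = g * a₂ := congrArg Subtype.val hc
    rw [← hc', h]
  have h0 : ((r : Module.End ℚ V) - g) * a₂ = 0 := by rw [sub_mul, hr', hga, sub_self]
  rcases hnzd _ _ (E.sub_mem (hRE _ r.2) hg) (hRE _ ha₂) h0 with h0 | h0
  · rw [sub_eq_zero] at h0
    rw [← h0]
    exact r.2
  · exact absurd h0 ha₂0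

/-! ### §4 The multiplier of a self-adjoint self-similitude is positive -/

/-- The complexification of a rational `ψ` commutes with complex conjugation:
`ψ(ȳ) = \overline{ψ(y)}` (`ψ = Θ ∘ (Ψ ⊗ ℂ) ∘ Θ⁻¹`). [cite: VoisinHodgeI2002, §7.1.1] -/
theorem apply_conjClass (hS : IsSmoothProjective 2 S) {ψ : complexBetti S (2 * 1) →ₗ[ℂ] complexBetti S (2 * 1)}
    {Ψ : bettiCohomology S (2 * 1) →ₗ[ℚ] bettiCohomology S (2 * 1)} (hΨ : ∀ v, ι[S] (Ψ v) = ψ (ι[S] v))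
    (y : complexBetti S (2 * 1)) :
    ψ (conjClass _ (2 * 1) y) = conjClass _ (2 * 1) (ψ y) := by
  obtain ⟨z, rfl⟩ := ofRatClassBaseChange_surjective hS (2 * 1) y
  rw [← ofRatClassBaseChange_conj_eq hS z, ← ofRatClassBaseChange_baseChange_eq hΨ (HodgeStructure.conj z),
    ← ofRatClassBaseChange_baseChange_eq hΨ z, ← ofRatClassBaseChange_conj_eq hS (Ψ.baseChange ℂ z),
    conj_baseChange]

/-- **The multiplier of a cup-self-adjoint rational Hodge self-similitude of `T(S)` is positive.** If
`ψ` is rational, type-preserving and cup-self-adjoint with `ψ(ψ σ) = d σ` for the `(2,0)`-class `σ ≠ 0`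
spanning `H^{2,0}(S)`, then `0 < d`: `ψσ = λσ`, `λ ∫σ∪σ̄ = ∫ψσ∪σ̄ = ∫σ∪ψσ̄ = λ̄ ∫σ∪σ̄` with
`∫σ∪σ̄ ≠ 0` forces `λ ∈ ℝ`, and `d = λ²`. [cite: Huybrechts2016K3, Ch. 3 Cor. 3.3.6] -/
theorem multiplier_pos (hS : IsSmoothProjective 2 S) {σ : complexBetti S (2 * 1)}
    (hσ : IsOfHodgeType 2 S (2 * 1) 2 0 σ) (hσ0 : σ ≠ 0)
    (hline : ∀ c : complexBetti S (2 * 1), IsOfHodgeType 2 S (2 * 1) 2 0 c → ∃ t : ℂ, c = t • σ)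
    (ψ : complexBetti S (2 * 1) →ₗ[ℂ] complexBetti S (2 * 1))
    (h1 : ∀ y, IsRationalClass y → IsRationalClass (ψ y))
    (h2 : ∀ (i j : ℕ) y, IsOfHodgeType 2 S (2 * 1) i j y → IsOfHodgeType 2 S (2 * 1) i j (ψ y))
    (h5 : ∀ y w : complexBetti S (2 * 1),
      cupProduct (rfl : 2 * 1 + 2 * 1 = 2 * 2) (ψ y) w = cupProduct (rfl : 2 * 1 + 2 * 1 = 2 * 2) y (ψ w))
    {d : ℚ} (hd : d ≠ 0) (hψψσ : ψ (ψ σ) = (d : ℂ) • σ) : 0 < d := by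
  obtain ⟨Ψ, hΨ⟩ := exists_ratLinear_ofRatClass_eq ψ h1
  obtain ⟨lam, hlam⟩ := hline _ (h2 2 0 σ hσ)
  -- `∫ σ ∪ σ̄ ≠ 0`
  obtain ⟨z, hz⟩ := ofRatClassBaseChange_surjective hS (2 * 1) σ
  have hzp : z ∈ (H²[hS]).piece 2 0 := by rw [mem_piece_two_zero_iff hS, hz]; exact hσ
  have hz0 : z ≠ 0 := by rintro rfl; exact hσ0 (by rw [← hz, map_zero])
  have hHR := cupPairingBetti_twoZero_conj_ne_zero hS z hzp hz0
  rw [cupPairingBetti_baseChange_eq_traceC, ofRatClassBaseChange_conj_eq hS, hz] at hHR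
  -- `λ t₀ = λ̄ t₀`
  have hconj : ψ (conjClass _ (2 * 1) σ) = starRingEnd ℂ lam • conjClass _ (2 * 1) σ := by
    rw [apply_conjClass hS hΨ, hlam, conjClass_smul]
  have hreal : lam = starRingEnd ℂ lam := by
    have h := congrArg (traceC hS) (h5 σ (conjClass _ (2 * 1) σ))
    rw [hlam, hconj, LinearMap.map_smul₂, map_smul, map_smul, map_smul, smul_eq_mul, smul_eq_mul] at h
    exact mul_right_cancel₀ hHR h
  -- `d = λ²`
  have hd2 : (d : ℂ) = lam * lam := by
    have h := hψψσ
    rw [hlam, map_smul, hlam, smul_smul] at h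
    exact (smul_left_injective ℂ hσ0 h).symm
  have him : lam.im = 0 := Complex.conj_eq_iff_im.1 hreal.symm
  have hdre : (d : ℝ) = lam.re * lam.re := by
    have h := congrArg Complex.re hd2
    rw [Complex.mul_re, him, mul_zero, sub_zero] at h
    exact_mod_cast h
  have hre0 : lam.re ≠ 0 := by
    intro h0
    apply hd
    have : (d : ℝ) = 0 := by rw [hdre, h0, mul_zero]
    exact_mod_cast this
  have hd' : (0 : ℝ) < d := by
    rw [hdre]
    exact mul_self_pos.2 hre0
  exact_mod_cast hd'

end Summit.HodgeConjecture.HodgeConjecture.Theorems.MarkmanPartnerTransport.KugaSatakeSelf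

end
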